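import Summits.ValiantsHypothesis.ValiantsHypothesis.Theorems.LangWeilTransferTameResolutionEliminant

/-!
# LangWeilTransfer, support item `TameResolution` (stmt-ValiantsHypothesis-6378) — the eliminant
# identity after specialising the combination coefficients

Route `LangWeilTransfer` of `ValiantsHypothesis` (conditional route; honest framing: bookkeeping,
nothing here bears on VP ≠ VNP). First step of (P) in the architecture note of val-lit-p6 g9: the
identity of `eliminant_identity` lives in `F₀[Λ, α]`; specialising the indeterminate combination
coefficients `α ↦ a ∈ ℤ^{n×t}` inside the universal ring gives the polynomial
`𝒬_a = (sLead P).map σ_a ∈ ℤ[T][Λ][U]` and the identity `𝒬_a(T̄, Λ, Σ_j ξ_j Λ_j) = 0` in `F₀[Λ]`,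
in the `eval₂ (map θ)` form consumed by `derivative_identity`.

* `eliminant_identity_specialize` — the specialised identity.
-/

noncomputable section

open MvPolynomial
open Literature.RingTheory.Elimination

-- the summit and the problem share the name `ValiantsHypothesis` (D-0017 single-conjunct layout)
set_option linter.dupNamespace false

namespace Summit.ValiantsHypothesis.ValiantsHypothesis.Theorems.LangWeilTransfer

variable {F₀ : Type*} [Field F₀] {r n t d : ℕ}

/-- **The specialised eliminant identity.** In the setting of `eliminant_identity`, for every
integer matrix `a`, with `σ_a : ℤ[T ⊔ Λ ⊔ α] → ℤ[T][Λ]` (`T ↦ T`, `Λ ↦ Λ`, `α ↦ a`) and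
`θ = φ ∘ C : ℤ[T] → F₀`, the polynomial `𝒬_a = (sLead P).map σ_a ∈ ℤ[T][Λ][U]` satisfies
`eval₂ (map θ) (Σ_j ξ_j Λ_j) 𝒬_a = 0` in `F₀[Λ]`. -/
theorem eliminant_identity_specialize
    (S : Fin t → MvPolynomial (Fin n) (MvPolynomial (Fin r) ℤ)) (hSd : ∀ k, (S k).totalDegree ≤ d)
    (φ : MvPolynomial (Fin n) (MvPolynomial (Fin r) ℤ) →+* F₀)
    (hT : Function.Injective (φ.comp MvPolynomial.C))
    (halg : ∀ j, ∃ P : Polynomial (MvPolynomial (Fin r) ℤ), P ≠ 0 ∧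
      (P.map (φ.comp MvPolynomial.C)).eval (φ (X j)) = 0)
    (hSφ : ∀ k, φ (S k) = 0)
    (hmin : ∀ 𝔮 : Ideal (MvPolynomial (Fin n) (MvPolynomial (Fin r) ℤ)), 𝔮.IsPrime →
      Ideal.span (Set.range S) ≤ 𝔮 → 𝔮 ≤ RingHom.ker φ → 𝔮 = RingHom.ker φ)
    (a : Fin n × Fin t → ℤ) :
    let ι := Fin r ⊕ (Fin n ⊕ (Fin n × Fin t))
    let F : Fin n → MvPolynomial (Fin n) (MvPolynomial ι ℤ) := fun i =>
      ∑ k, C (X (Sum.inr (Sum.inr (i, k)))) *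
        MvPolynomial.map (rename (Sum.inl : Fin r → ι) : MvPolynomial (Fin r) ℤ →ₐ[ℤ] MvPolynomial ι ℤ).toRingHom (S k)
    let u : MvPolynomial (Fin n) (MvPolynomial ι ℤ) := ∑ j, C (X (Sum.inr (Sum.inl j))) * X j
    let σa : MvPolynomial ι ℤ →+* MvPolynomial (Fin n) (MvPolynomial (Fin r) ℤ) :=
      eval₂Hom (C.comp C) (Sum.elim (fun k => C (X k)) (Sum.elim (fun j => X j) (fun p => C (C (a p)))))
    Polynomial.eval₂ (MvPolynomial.map (φ.comp MvPolynomial.C)) (∑ j, C (φ (X j)) * X j)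
      ((sLead (pertCharpoly (d + 1) F u (1 + n * d + 1))).map σa) = 0 := by
  intro ι F u σa
  have hid := eliminant_identity S hSd φ hT halg hSφ hmin
  simp only at hid
  set P := pertCharpoly (d + 1) F u (1 + n * d + 1) with hP
  set Ψ : MvPolynomial ι ℤ →+* MvPolynomial (Fin n ⊕ (Fin n × Fin t)) F₀ :=
    eval₂Hom (Int.castRingHom _) (Sum.elim (fun k => C (φ (C (X k)))) (fun v => X v)) with hΨ
  -- the specialisation `α ↦ a` on `F₀[Λ ⊔ α]`
  set eva : MvPolynomial (Fin n ⊕ (Fin n × Fin t)) F₀ →+* MvPolynomial (Fin n) F₀ :=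
    eval₂Hom C (Sum.elim (fun j => X j) (fun p => C ((a p : ℤ) : F₀))) with heva
  have hcomp : eva.comp Ψ = (MvPolynomial.map (φ.comp MvPolynomial.C)).comp σa := by
    refine MvPolynomial.ringHom_ext (fun b => ?_) (fun v => ?_)
    · simp only [eq_intCast, map_intCast]
    · rcases v with k | j | p
      · simp only [hΨ, heva, σa, RingHom.comp_apply, eval₂Hom_X', Sum.elim_inl, eval₂Hom_C, map_C]
      · simp only [hΨ, heva, σa, RingHom.comp_apply, eval₂Hom_X', Sum.elim_inr, Sum.elim_inl, map_X]
      · simp only [hΨ, heva, σa, RingHom.comp_apply, eval₂Hom_X', Sum.elim_inr, eq_intCast,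
          map_intCast]
  have hpt : eva (∑ j, C (φ (X j)) * X (Sum.inl j)) = ∑ j, C (φ (X j)) * X j := by
    simp only [heva, map_sum, map_mul, eval₂Hom_C, eval₂Hom_X', Sum.elim_inl]
  have h := congrArg eva hid
  rw [map_zero, Polynomial.eval_map, Polynomial.hom_eval₂, hcomp, hpt, ← Polynomial.eval₂_map] at h
  exact h

end Summit.ValiantsHypothesis.ValiantsHypothesis.Theorems.LangWeilTransfer
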